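import Literature.Analysis.FluidPDE.SelfSimilarEulerL3Exclusion
import Mathlib.Analysis.Calculus.ParametricIntervalIntegral
import HarnessLib

/-!
# Chae–Shvydkoy 2013, eq. (2.9): the exact two-scale local energy identity of a self-similar
# Euler profile — proofs companion (first stage of the discharge of `chaeShvydkoy2013_energy_growth`)

Analysis/FluidPDE proof file (theorems only; no definitions, no named facts, no `sorry`) in the
story of `SelfSimilarEulerLpExclusion.lean` (the NAMED FACT `chaeShvydkoy2013_energy_growth` =
D. Chae, R. Shvydkoy, *On formation of a locally self-similar collapse in the incompressible Euler
equations*, Arch. Ration. Mech. Anal. **209** (2013) 999–1017 = arXiv:1201.6009 [ChaeShvydkoy2013],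
**Corollary 3.4**). CS13 derive all their velocity-based exclusions from the two-time local energy
equality written in self-similar variables, eq. (2.9): for `0 < l₁ < l₂`,

> `| l₂^{2α−N} ∫ |v|² σ(y/l₂) dy − l₁^{2α−N} ∫ |v|² σ(y/l₁) dy | ≤ C ∫_{l₁/2 ≤ |y| ≤ l₂} (|v|³ + |q||v|) |y|^{2α−N−1} dy`
> ("This inequality will be our starting point in much of what follows").

The tree's `SelfSimilarEulerL3Exclusion.lean` / `SelfSimilarEulerLpTwoScale.lean` prove ONE-SIDED
forms of (2.9) adapted to Theorem 3.2 (`twoScale_ineq`, `ball_energy_le_weightedFlux`: the large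
scale sent to infinity; `ball_energy_le_localFlux`: `α > 3/2`; `annular_energy_le_of_window`: an
annulus at `p = 3`). Corollary 3.4 (the window `N/p < α ≤ N/2`, §3.2.3, "`l₁ = 2` fixed") needs
the EXACT identity with a fixed inner scale, which is proved here for `C²` profiles and EVERY
exponent `α ≠ −1`, from the stationary local energy identity of the tree
(`IsSelfSimilarEulerProfile.localEnergy_identity_radial`) with a two-scale radial test function:

* `exists_twoScaleProfile` — for every `κ` (`= α − 3/2`) a `C¹` profile `Ξ_κ : ℝ → ℝ`, constant
  near `0`, vanishing on `[4, ∞)`, with `2κ Ξ(u) − 2u Ξ'(u) = 4^κ σ(u/4) − σ(u)` for the cut-off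
  `σ(t) = smoothTransition (2 − 2t)` (`= 1` on `t ≤ ½`, `= 0` on `t ≥ 1`): explicitly
  `Ξ(u) = ∫_{1/4}^{1} σ(uτ) τ^{−κ−1}/2 dτ` (= the difference of the singular one-scale solutions
  `s^κ ∫_s^∞ σ(t) t^{−κ−1}/2 dt` at scales `1` and `2`; the singularities at `0` cancel);
* `IsSelfSimilarEulerProfile.twoScale_energy_step` — the ONE-STEP identity/inequality: with
  `E(λ) = λ^{2α−3} ∫ σ(|y|²/λ²) |U|²`,
  `|E(2l) − E(l)| ≤ C l^{2α−4} ∫_{l²/2 ≤ |y|² ≤ 4l²} (|U|³ + 2|P||U|)` for all `l > 0`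
  (test function `Φ(s) = l^{2κ} Ξ(s/l²)`, whose weight `(2α−3)Φ − 2sΦ'` is exactly
  `(2l)^{2α−3}σ(s/(2l)²) − l^{2α−3}σ(s/l²)`);
* `IsSelfSimilarEulerProfile.twoScale_energy_dyadic` — CS13 (2.9) for dyadic ratios:
  `|E(2^k l) − E(l)| ≤ C Σ_{j<k} (2^j l)^{2α−4} ∫_{(2^j l)²/2 ≤ |y|² ≤ 4(2^j l)²} (|U|³ + 2|P||U|)`;
* `ball_energy_le_twoScaleEnergy`, `twoScaleEnergy_le_ball_energy` — `λ^{2α−3}∫_{|y|<λ/2}|U|² ≤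
  E(λ) ≤ λ^{2α−3}∫_{|y|<λ}|U|²`.

Deliberately NOT here: the bootstrap of §3.2.2–§3.2.3 for `3 < p < ∞` (second stage).

## Mathlib / tree search

Reused: `IsSelfSimilarEulerProfile.localEnergy_identity_radial` (`SelfSimilarEulerL3Exclusion.lean`),
`Literature.Analysis.Calculus.{differentiable_smoothTransition, deriv_smoothTransition_of_nonpos,
deriv_smoothTransition_of_one_le, exists_bound_deriv_smoothTransition}` (`Calculus/SmoothCutoff.lean`);
Mathlib `intervalIntegral.hasDerivAt_integral_of_dominated_loc_of_deriv_le`,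
`intervalIntegral.continuous_parametric_intervalIntegral_of_continuous'`,
`intervalIntegral.integral_eq_sub_of_hasDerivAt`, `Real.hasDerivAt_rpow_const`,
`contDiff_one_iff_deriv`. No new definitions, no instances, no notation.

## References

* D. Chae, R. Shvydkoy, ARMA 209 (2013) = arXiv:1201.6009, §2.2 eq. (2.8)–(2.9) (p. 5 of the
  arXiv version), §3.2.2 eq. (3.17), §3.2.3 Cor. 3.4. [ChaeShvydkoy2013]
-/

noncomputable section

open MeasureTheory Set Filter Topology Metric InnerProductSpace
open scoped RealInnerProductSpace ENNReal NNReal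

namespace Literature.Analysis.FluidPDE

/-! ## The two-scale profile `Ξ_κ` -/

/-- **The two-scale radial profile.** For every real `κ` there is a `C¹` function `Ξ : ℝ → ℝ` with
`Ξ = 0` on `[4, ∞)`, `Ξ' = 0` on `(−∞, ½] ∪ [4, ∞)`, `|Ξ'| ≤ M`, and the weight identity
`2κ Ξ(u) − 2u Ξ'(u) = 4^κ σ(u/4) − σ(u)`, `σ(t) = smoothTransition (2 − 2t)`. It is
`Ξ(u) = ∫_{1/4}^1 σ(uτ) τ^{−κ−1}/2 dτ`: differentiating under the integral and integrating
`−∂_τ(σ(uτ) τ^{−κ})` by parts gives the identity (CS13 obtain the corresponding two-time identity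
(2.9) from the time-dependent local energy equality (2.6) with a fixed cut-off `σ`).
[cite: ChaeShvydkoy2013, §2.2 eqs. (2.8)–(2.9)] -/
theorem exists_twoScaleProfile (κ : ℝ) :
    ∃ Ξ : ℝ → ℝ, ContDiff ℝ 1 Ξ ∧ (∀ u, 4 ≤ u → Ξ u = 0) ∧ (∃ M, ∀ u, |deriv Ξ u| ≤ M) ∧
      (∀ u, u ≤ 1 / 2 → deriv Ξ u = 0) ∧ (∀ u, 4 ≤ u → deriv Ξ u = 0) ∧
      (∀ u, 2 * κ * Ξ u - 2 * u * deriv Ξ u =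
        (4 : ℝ) ^ κ * Real.smoothTransition (2 - 2 * (u / 4)) - Real.smoothTransition (2 - 2 * u)) := by
  -- the cut-off `σ` and its derivative
  set σf : ℝ → ℝ := fun t => Real.smoothTransition (2 - 2 * t) with hσf_def
  set dσ : ℝ → ℝ := fun t => deriv Real.smoothTransition (2 - 2 * t) * (-2) with hdσ_def
  have hσd : ∀ t, HasDerivAt σf (dσ t) t := fun t => by
    have h1 : HasDerivAt (fun t : ℝ => 2 - 2 * t) (-2) t := by
      simpa using ((hasDerivAt_id t).const_mul (2 : ℝ)).const_sub 2
    exact (Calculus.differentiable_smoothTransition _).hasDerivAt.comp t h1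
  have hσ_cont : Continuous σf :=
    Real.smoothTransition.continuous.comp (continuous_const.sub (continuous_const.mul continuous_id))
  have hdσ_cont : Continuous dσ :=
    (((Real.smoothTransition.contDiff (n := 1)).continuous_deriv le_rfl).comp
      (continuous_const.sub (continuous_const.mul continuous_id))).mul continuous_const
  have hσ_one : ∀ t, t ≤ 1 / 2 → σf t = 1 := fun t ht =>
    Real.smoothTransition.one_of_one_le (by linarith)
  have hσ_zero : ∀ t, 1 ≤ t → σf t = 0 := fun t ht =>
    Real.smoothTransition.zero_of_nonpos (by linarith)
  have hdσ_zero_of_le : ∀ t, t ≤ 1 / 2 → dσ t = 0 := fun t ht => by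
    simp only [hdσ_def]
    rw [Calculus.deriv_smoothTransition_of_one_le (by linarith), zero_mul]
  have hdσ_zero_of_ge : ∀ t, 1 ≤ t → dσ t = 0 := fun t ht => by
    simp only [hdσ_def]
    rw [Calculus.deriv_smoothTransition_of_nonpos (by linarith), zero_mul]
  obtain ⟨D, hD0, hD⟩ := Calculus.exists_bound_deriv_smoothTransition
  have hdσ_bd : ∀ t, |dσ t| ≤ 2 * D := fun t => by
    simp only [hdσ_def]
    rw [abs_mul, abs_neg, abs_two]
    nlinarith [hD (2 - 2 * t), abs_nonneg (deriv Real.smoothTransition (2 - 2 * t))]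
  -- the regularised weight `w(τ) = (2 (max τ 1/8)^{κ+1})⁻¹` (`= τ^{−κ−1}/2` on `[1/4, 1]`)
  set m : ℝ → ℝ := fun τ => max τ (1 / 8) with hm_def
  have hm_pos : ∀ τ, 0 < m τ := fun τ => lt_max_of_lt_right (by norm_num)
  have hm_cont : Continuous m := continuous_id.max continuous_const
  set w : ℝ → ℝ := fun τ => (2 * m τ ^ (κ + 1))⁻¹ with hw_def
  have hw_cont : Continuous w := by
    refine ((continuous_const.mul (hm_cont.rpow_const fun τ => Or.inl (hm_pos τ).ne')).inv₀
      fun τ => ?_)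
    exact mul_ne_zero two_ne_zero (Real.rpow_pos_of_pos (hm_pos τ) _).ne'
  have hm_eq : ∀ τ ∈ uIcc (1 / 4 : ℝ) 1, m τ = τ := fun τ hτ => by
    rw [uIcc_of_le (by norm_num : (1 / 4 : ℝ) ≤ 1)] at hτ
    exact max_eq_left (by linarith [hτ.1])
  -- the integrand and its `u`-derivative
  set F : ℝ → ℝ → ℝ := fun u τ => σf (u * τ) * w τ with hF_def
  set F' : ℝ → ℝ → ℝ := fun u τ => dσ (u * τ) * τ * w τ with hF'_def
  have hF_cont : Continuous (Function.uncurry F) :=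
    (hσ_cont.comp (continuous_fst.mul continuous_snd)).mul (hw_cont.comp continuous_snd)
  have hF'_cont : Continuous (Function.uncurry F') :=
    ((hdσ_cont.comp (continuous_fst.mul continuous_snd)).mul continuous_snd).mul
      (hw_cont.comp continuous_snd)
  have hFd : ∀ τ u, HasDerivAt (fun x => F x τ) (F' u τ) u := fun τ u => by
    have h1 : HasDerivAt (fun x : ℝ => x * τ) τ u := by simpa using (hasDerivAt_id u).mul_const τ
    have h2 : HasDerivAt (fun x : ℝ => σf (x * τ)) (dσ (u * τ) * τ) u := by
      have := (hσd (u * τ)).comp u h1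
      simpa [Function.comp_def] using this
    exact h2.mul_const (w τ)
  -- the profile and its derivative
  set Ξ : ℝ → ℝ := fun u => ∫ τ in (1 / 4 : ℝ)..1, F u τ with hΞ_def
  have hderiv : ∀ u, HasDerivAt Ξ (∫ τ in (1 / 4 : ℝ)..1, F' u τ) u := fun u => by
    have key := intervalIntegral.hasDerivAt_integral_of_dominated_loc_of_deriv_le
      (μ := volume) (a := (1 / 4 : ℝ)) (b := 1) (F := F) (F' := F') (x₀ := u) (s := univ)
      (bound := fun τ => 2 * D * |τ| * |w τ|) univ_mem
      (Eventually.of_forall fun x =>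
        (hF_cont.comp (continuous_const.prodMk continuous_id)).aestronglyMeasurable)
      ((hF_cont.comp (continuous_const.prodMk continuous_id)).intervalIntegrable _ _)
      ((hF'_cont.comp (continuous_const.prodMk continuous_id)).aestronglyMeasurable)
      (Eventually.of_forall fun τ _ x _ => by
        change |dσ (x * τ) * τ * w τ| ≤ 2 * D * |τ| * |w τ|
        rw [abs_mul, abs_mul]
        gcongr
        exact hdσ_bd _)
      (((continuous_const.mul continuous_abs).mul (hw_cont.abs)).intervalIntegrable _ _)
      (Eventually.of_forall fun τ _ x _ => hFd τ x)
    exact key.2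
  have hderiv_eq : ∀ u, deriv Ξ u = ∫ τ in (1 / 4 : ℝ)..1, F' u τ := fun u => (hderiv u).deriv
  have hΞ'_cont : Continuous fun u => ∫ τ in (1 / 4 : ℝ)..1, F' u τ :=
    intervalIntegral.continuous_parametric_intervalIntegral_of_continuous' hF'_cont _ _
  have hC1 : ContDiff ℝ 1 Ξ := by
    rw [contDiff_one_iff_deriv]
    refine ⟨fun u => (hderiv u).differentiableAt, ?_⟩
    rw [show deriv Ξ = fun u => ∫ τ in (1 / 4 : ℝ)..1, F' u τ from funext hderiv_eq]
    exact hΞ'_cont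
  -- support properties
  have hIcc : ∀ τ ∈ uIcc (1 / 4 : ℝ) 1, 1 / 4 ≤ τ ∧ τ ≤ 1 := fun τ hτ => by
    rw [uIcc_of_le (by norm_num : (1 / 4 : ℝ) ≤ 1)] at hτ
    exact hτ
  have hΞ_zero : ∀ u, 4 ≤ u → Ξ u = 0 := fun u hu => by
    simp only [hΞ_def]
    rw [intervalIntegral.integral_congr (g := fun _ => (0 : ℝ)) fun τ hτ => ?_]
    · simp
    · obtain ⟨h1, -⟩ := hIcc τ hτ
      change σf (u * τ) * w τ = 0
      rw [hσ_zero _ (by nlinarith), zero_mul]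
  have hΞ'_zero_lo : ∀ u, u ≤ 1 / 2 → deriv Ξ u = 0 := fun u hu => by
    rw [hderiv_eq, intervalIntegral.integral_congr (g := fun _ => (0 : ℝ)) fun τ hτ => ?_]
    · simp
    · obtain ⟨h1, h2⟩ := hIcc τ hτ
      change dσ (u * τ) * τ * w τ = 0
      have hut : u * τ ≤ 1 / 2 := by
        rcases le_or_gt u 0 with hu0 | hu0
        · nlinarith
        · nlinarith
      rw [hdσ_zero_of_le _ hut, zero_mul, zero_mul]
  have hΞ'_zero_hi : ∀ u, 4 ≤ u → deriv Ξ u = 0 := fun u hu => by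
    rw [hderiv_eq, intervalIntegral.integral_congr (g := fun _ => (0 : ℝ)) fun τ hτ => ?_]
    · simp
    · obtain ⟨h1, -⟩ := hIcc τ hτ
      change dσ (u * τ) * τ * w τ = 0
      rw [hdσ_zero_of_ge _ (by nlinarith), zero_mul, zero_mul]
  -- derivative bound
  obtain ⟨W, hW⟩ := isCompact_Icc.exists_bound_of_continuousOn
    (hw_cont.continuousOn (s := Icc (1 / 4 : ℝ) 1))
  have hΞ'_bd : ∀ u, |deriv Ξ u| ≤ 2 * D * W * |1 - 1 / 4| := fun u => by
    rw [hderiv_eq]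
    have := intervalIntegral.norm_integral_le_of_norm_le_const (a := (1 / 4 : ℝ)) (b := 1)
      (f := fun τ => F' u τ) (C := 2 * D * W) fun τ hτ => by
        rw [uIoc_of_le (by norm_num : (1 / 4 : ℝ) ≤ 1)] at hτ
        have hτI : τ ∈ Icc (1 / 4 : ℝ) 1 := ⟨hτ.1.le, hτ.2⟩
        change ‖dσ (u * τ) * τ * w τ‖ ≤ 2 * D * W
        rw [Real.norm_eq_abs, abs_mul, abs_mul]
        have hτ1 : |τ| ≤ 1 := by rw [abs_of_pos (by linarith [hτ.1])]; exact hτ.2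
        have hWτ : |w τ| ≤ W := by simpa [Real.norm_eq_abs] using hW τ hτI
        have hW0 : 0 ≤ W := (abs_nonneg _).trans hWτ
        calc |dσ (u * τ)| * |τ| * |w τ| ≤ 2 * D * 1 * W :=
              mul_le_mul (mul_le_mul (hdσ_bd _) hτ1 (abs_nonneg _) (by positivity)) hWτ
                (abs_nonneg _) (by positivity)
          _ = 2 * D * W := by ring
    simpa [Real.norm_eq_abs] using this
  -- the weight identity, by parts in `τ`
  have hweight : ∀ u, 2 * κ * Ξ u - 2 * u * deriv Ξ u = (4 : ℝ) ^ κ * σf (u / 4) - σf u := by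
    intro u
    -- the antiderivative `G(τ) = σ(uτ) τ^{−κ}` on `τ > 0`
    set G : ℝ → ℝ := fun τ => σf (u * τ) * τ ^ (-κ) with hG_def
    set G' : ℝ → ℝ := fun τ => dσ (u * τ) * u * τ ^ (-κ) + σf (u * τ) * (-κ * τ ^ (-κ - 1))
      with hG'_def
    have hGd : ∀ τ, 0 < τ → HasDerivAt G (G' τ) τ := fun τ hτ => by
      have h1 : HasDerivAt (fun τ : ℝ => u * τ) u τ := by simpa using (hasDerivAt_id τ).const_mul u
      have h2 : HasDerivAt (fun τ : ℝ => σf (u * τ)) (dσ (u * τ) * u) τ := by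
        have := (hσd (u * τ)).comp τ h1
        simpa [Function.comp_def] using this
      have h3 : HasDerivAt (fun τ : ℝ => τ ^ (-κ)) (-κ * τ ^ (-κ - 1)) τ :=
        Real.hasDerivAt_rpow_const (Or.inl hτ.ne')
      exact h2.mul h3
    have hG'_cont : ContinuousOn G' (uIcc (1 / 4 : ℝ) 1) := by
      rw [uIcc_of_le (by norm_num : (1 / 4 : ℝ) ≤ 1)]
      have hpow : ∀ e : ℝ, ContinuousOn (fun τ : ℝ => τ ^ e) (Icc (1 / 4 : ℝ) 1) := fun e =>
        (continuousOn_id.rpow_const fun τ hτ => Or.inl (by linarith [hτ.1] : τ ≠ 0))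
      refine ((((hdσ_cont.comp (continuous_const.mul continuous_id)).continuousOn).mul
        continuousOn_const).mul (hpow _)).add
        (((hσ_cont.comp (continuous_const.mul continuous_id)).continuousOn).mul
          (continuousOn_const.mul (hpow _)))
    -- the integrand of `2κ Ξ − 2u Ξ'` is `−G'` on `[1/4, 1]`
    have hint : ∀ τ ∈ uIcc (1 / 4 : ℝ) 1,
        2 * κ * F u τ - 2 * u * F' u τ = -G' τ := fun τ hτ => by
      obtain ⟨h1, -⟩ := hIcc τ hτ
      have hτ0 : 0 < τ := by linarith
      have hmτ : m τ = τ := hm_eq τ hτ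
      simp only [hF_def, hF'_def, hG'_def, hw_def, hmτ]
      have e1 : τ ^ (-κ - 1) = (τ ^ (κ + 1))⁻¹ := by
        rw [show -κ - 1 = -(κ + 1) by ring, Real.rpow_neg hτ0.le]
      have e2 : τ ^ (-κ) = τ * (τ ^ (κ + 1))⁻¹ := by
        rw [← e1]
        conv_lhs => rw [show (-κ : ℝ) = 1 + (-κ - 1) by ring]
        rw [Real.rpow_add hτ0, Real.rpow_one]
      rw [e1, e2]
      have hne : τ ^ (κ + 1) ≠ 0 := (Real.rpow_pos_of_pos hτ0 _).ne'
      field_simp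
      ring
    have hFTC : ∫ τ in (1 / 4 : ℝ)..1, G' τ = G 1 - G (1 / 4) :=
      intervalIntegral.integral_eq_sub_of_hasDerivAt
        (fun τ hτ => hGd τ (by obtain ⟨h1, -⟩ := hIcc τ hτ; linarith))
        hG'_cont.intervalIntegrable
    have hFi : IntervalIntegrable (F u) volume (1 / 4 : ℝ) 1 :=
      (hF_cont.comp (continuous_const.prodMk continuous_id)).intervalIntegrable _ _
    have hF'i : IntervalIntegrable (F' u) volume (1 / 4 : ℝ) 1 :=
      (hF'_cont.comp (continuous_const.prodMk continuous_id)).intervalIntegrable _ _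
    calc 2 * κ * Ξ u - 2 * u * deriv Ξ u
        = ∫ τ in (1 / 4 : ℝ)..1, (2 * κ * F u τ - 2 * u * F' u τ) := by
          rw [hderiv_eq, intervalIntegral.integral_sub (hFi.const_mul _) (hF'i.const_mul _),
            intervalIntegral.integral_const_mul, intervalIntegral.integral_const_mul]
      _ = ∫ τ in (1 / 4 : ℝ)..1, -G' τ := intervalIntegral.integral_congr hint
      _ = -(G 1 - G (1 / 4)) := by rw [intervalIntegral.integral_neg, hFTC]
      _ = (4 : ℝ) ^ κ * σf (u / 4) - σf u := by
          simp only [hG_def, mul_one, Real.one_rpow, one_div]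
          rw [Real.inv_rpow (by norm_num : (0 : ℝ) ≤ 4), Real.rpow_neg (by norm_num : (0 : ℝ) ≤ 4),
            inv_inv, show u * (4 : ℝ)⁻¹ = u / 4 by ring]
          ring
  exact ⟨Ξ, hC1, hΞ_zero, ⟨_, hΞ'_bd⟩, hΞ'_zero_lo, hΞ'_zero_hi, hweight⟩


/-! ## The two-scale energy `E(λ) = λ^{2α−3} ∫ σ(|y|²/λ²) |U|²` and the ball energies -/

/-- The cut-off energy integrand `σ(|y|²/λ²)|U(y)|²` is continuous and compactly supported, hence
integrable. [folklore] -/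
private theorem integrable_cutoff_energy {U : EuclideanSpace ℝ (Fin 3) → EuclideanSpace ℝ (Fin 3)}
    (hU : Continuous U) {lam : ℝ} (hlam : 0 < lam) :
    Integrable (fun y : EuclideanSpace ℝ (Fin 3) =>
      Real.smoothTransition (2 - 2 * (‖y‖ ^ 2 / lam ^ 2)) * ‖U y‖ ^ 2) := by
  have hc : Continuous fun y : EuclideanSpace ℝ (Fin 3) =>
      Real.smoothTransition (2 - 2 * (‖y‖ ^ 2 / lam ^ 2)) * ‖U y‖ ^ 2 :=
    (Real.smoothTransition.continuous.comp (continuous_const.sub (continuous_const.mul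
      ((continuous_norm.pow 2).div_const _)))).mul (hU.norm.pow 2)
  refine hc.integrable_of_hasCompactSupport ?_
  refine HasCompactSupport.of_support_subset_isCompact (isCompact_closedBall (0 : _) lam) ?_
  intro y hy
  rw [mem_closedBall, dist_zero_right]
  by_contra hgt
  push Not at hgt
  apply hy
  have h1 : 1 ≤ ‖y‖ ^ 2 / lam ^ 2 := by
    rw [le_div_iff₀ (by positivity), one_mul]
    exact pow_le_pow_left₀ hlam.le hgt.le 2
  change Real.smoothTransition (2 - 2 * (‖y‖ ^ 2 / lam ^ 2)) * ‖U y‖ ^ 2 = 0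
  rw [Real.smoothTransition.zero_of_nonpos (by linarith), zero_mul]

/-- **The cut-off energy dominates the energy of the half ball**:
`λ^{2α−3} ∫_{|y|<λ/2} |U|² ≤ E(λ)` (`σ(|y|²/λ²) = 1` for `|y|² ≤ λ²/2`).
[cite: ChaeShvydkoy2013, §2.2 eq. (2.9) (the cut-off `σ = 1` on `r ≤ 1/2`)] -/
theorem ball_energy_le_twoScaleEnergy {α : ℝ}
    {U : EuclideanSpace ℝ (Fin 3) → EuclideanSpace ℝ (Fin 3)} (hU : Continuous U)
    {lam : ℝ} (hlam : 0 < lam) :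
    lam ^ (2 * α - 3) * ∫ y in ball (0 : EuclideanSpace ℝ (Fin 3)) (lam / 2), ‖U y‖ ^ 2 ≤
      lam ^ (2 * α - 3) * ∫ y, Real.smoothTransition (2 - 2 * (‖y‖ ^ 2 / lam ^ 2)) * ‖U y‖ ^ 2 := by
  refine mul_le_mul_of_nonneg_left ?_ (Real.rpow_nonneg hlam.le _)
  rw [← MeasureTheory.integral_indicator measurableSet_ball]
  refine integral_mono_of_nonneg (Eventually.of_forall fun y => ?_) (integrable_cutoff_energy hU hlam)
    (Eventually.of_forall fun y => ?_)
  · exact Set.indicator_nonneg (fun _ _ => by positivity) _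
  · dsimp only
    by_cases hy : y ∈ ball (0 : EuclideanSpace ℝ (Fin 3)) (lam / 2)
    · rw [indicator_of_mem hy]
      rw [mem_ball, dist_zero_right] at hy
      have hσ : Real.smoothTransition (2 - 2 * (‖y‖ ^ 2 / lam ^ 2)) = 1 := by
        apply Real.smoothTransition.one_of_one_le
        have : ‖y‖ ^ 2 / lam ^ 2 ≤ 1 / 2 := by
          rw [div_le_iff₀ (by positivity)]
          nlinarith [norm_nonneg y]
        linarith
      rw [hσ, one_mul]
    · rw [indicator_of_notMem hy]
      exact mul_nonneg (Real.smoothTransition.nonneg _) (by positivity)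

/-- **The cut-off energy is dominated by the energy of the double ball**:
`E(λ) ≤ λ^{2α−3} ∫_{|y|<2λ} |U|²` (`0 ≤ σ ≤ 1`, `σ(|y|²/λ²) = 0` for `|y| ≥ λ`).
[cite: ChaeShvydkoy2013, §2.2 eq. (2.9) (the cut-off `σ = 0` on `r > 1`)] -/
theorem twoScaleEnergy_le_ball_energy {α : ℝ}
    {U : EuclideanSpace ℝ (Fin 3) → EuclideanSpace ℝ (Fin 3)} (hU : Continuous U)
    {lam : ℝ} (hlam : 0 < lam) :
    lam ^ (2 * α - 3) * ∫ y, Real.smoothTransition (2 - 2 * (‖y‖ ^ 2 / lam ^ 2)) * ‖U y‖ ^ 2 ≤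
      lam ^ (2 * α - 3) * ∫ y in ball (0 : EuclideanSpace ℝ (Fin 3)) (2 * lam), ‖U y‖ ^ 2 := by
  refine mul_le_mul_of_nonneg_left ?_ (Real.rpow_nonneg hlam.le _)
  rw [← MeasureTheory.integral_indicator measurableSet_ball]
  have hint : Integrable ((ball (0 : EuclideanSpace ℝ (Fin 3)) (2 * lam)).indicator
      fun y => ‖U y‖ ^ 2) volume :=
    (((hU.norm.pow 2).continuousOn.integrableOn_compact
      (isCompact_closedBall (0 : EuclideanSpace ℝ (Fin 3)) (2 * lam))).mono_set
      ball_subset_closedBall).integrable_indicator measurableSet_ball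
  refine integral_mono_of_nonneg (Eventually.of_forall fun y =>
    mul_nonneg (Real.smoothTransition.nonneg _) (by positivity)) hint
    (Eventually.of_forall fun y => ?_)
  dsimp only
  by_cases hy : y ∈ ball (0 : EuclideanSpace ℝ (Fin 3)) (2 * lam)
  · rw [indicator_of_mem hy]
    exact mul_le_of_le_one_left (by positivity) (Real.smoothTransition.le_one _)
  · rw [indicator_of_notMem hy]
    rw [mem_ball, dist_zero_right, not_lt] at hy
    have h1 : 1 ≤ ‖y‖ ^ 2 / lam ^ 2 := by
      rw [le_div_iff₀ (by positivity), one_mul]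
      exact pow_le_pow_left₀ hlam.le (by linarith) 2
    rw [Real.smoothTransition.zero_of_nonpos (by linarith), zero_mul]

/-! ## The one-step identity and CS13 (2.9) for dyadic ratios -/

/-- **Chae–Shvydkoy 2013, eq. (2.9), one dyadic step, for `C²` profiles.** Let `(U, P)` be a
stationary self-similar Euler profile with exponent `γ = 1/(α+1)` (`α ≠ −1`), and put
`E(λ) = λ^{2α−3} ∫ σ(|y|²/λ²)|U|²` with `σ(t) = smoothTransition (2 − 2t)`. Then for every `l > 0`
`|E(2l) − E(l)| ≤ C l^{2α−4} ∫_{l²/2 ≤ |y|² ≤ 4l²} (|U|³ + 2|P||U|)`, `C` depending on `α` only: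
the radial local energy identity (`localEnergy_identity_radial`) with the two-scale test function
`Φ(s) = l^{2α−3} Ξ_{α−3/2}(s/l²)` of `exists_twoScaleProfile`, whose weight
`(2α−3)Φ − 2sΦ'` is EXACTLY `(2l)^{2α−3}σ(s/(2l)²) − l^{2α−3}σ(s/l²)`, and
`|2Φ'(|y|²)⟪y, U⟫| ≤ 4M l^{2α−4}|U|` on the shell `l²/2 ≤ |y|² ≤ 4l²` (zero elsewhere).
[cite: ChaeShvydkoy2013, §2.2 eqs. (2.8)–(2.9)] -/
theorem IsSelfSimilarEulerProfile.twoScale_energy_step {α : ℝ}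
    {U : EuclideanSpace ℝ (Fin 3) → EuclideanSpace ℝ (Fin 3)} {P : EuclideanSpace ℝ (Fin 3) → ℝ}
    (h : IsSelfSimilarEulerProfile (1 / (α + 1)) 0 U P) (hα : α + 1 ≠ 0) :
    ∃ C : ℝ, 0 ≤ C ∧ ∀ l : ℝ, 0 < l →
      |(2 * l) ^ (2 * α - 3) *
            (∫ y, Real.smoothTransition (2 - 2 * (‖y‖ ^ 2 / (2 * l) ^ 2)) * ‖U y‖ ^ 2) -
          l ^ (2 * α - 3) * (∫ y, Real.smoothTransition (2 - 2 * (‖y‖ ^ 2 / l ^ 2)) * ‖U y‖ ^ 2)| ≤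
        C * l ^ (2 * α - 4) *
          ∫ y in {y : EuclideanSpace ℝ (Fin 3) | l ^ 2 / 2 ≤ ‖y‖ ^ 2 ∧ ‖y‖ ^ 2 ≤ 4 * l ^ 2},
            (‖U y‖ ^ 3 + 2 * (|P y| * ‖U y‖)) := by
  obtain ⟨Ξ, hC1, hΞ0, ⟨M, hM⟩, hlo, hhi, hweight⟩ := exists_twoScaleProfile (α - 3 / 2)
  have hM0 : 0 ≤ M := (abs_nonneg _).trans (hM 0)
  have hUc : Continuous U := h.contDiff_velocity.continuous
  have hPc : Continuous P := h.contDiff_pressure.continuous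
  refine ⟨|1 + α| * (4 * M), by positivity, fun l hl => ?_⟩
  have hl2 : 0 < l ^ 2 := by positivity
  -- the two-scale test function at scale `l`
  set Φ : ℝ → ℝ := fun s => l ^ (2 * α - 3) * Ξ (s / l ^ 2) with hΦ_def
  have hΞd : ∀ u, HasDerivAt Ξ (deriv Ξ u) u := fun u =>
    ((hC1.differentiable one_ne_zero) u).hasDerivAt
  have hΦd : ∀ s, HasDerivAt Φ (l ^ (2 * α - 3) * (deriv Ξ (s / l ^ 2) * (1 / l ^ 2))) s :=
    fun s => by
    have h1 : HasDerivAt (fun s : ℝ => s / l ^ 2) (1 / l ^ 2) s := by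
      simpa using (hasDerivAt_id s).div_const (l ^ 2)
    have h2 : HasDerivAt (fun s : ℝ => Ξ (s / l ^ 2)) (deriv Ξ (s / l ^ 2) * (1 / l ^ 2)) s := by
      have := (hΞd (s / l ^ 2)).comp s h1
      simpa [Function.comp_def] using this
    exact h2.const_mul _
  have hΦ' : ∀ s, deriv Φ s = l ^ (2 * α - 3) / l ^ 2 * deriv Ξ (s / l ^ 2) := fun s => by
    rw [(hΦd s).deriv]
    ring
  have hΦ1 : ContDiff ℝ 1 Φ := contDiff_const.mul (hC1.comp (contDiff_id.div_const _))
  have hΦT : ∀ t, 4 * l ^ 2 ≤ t → Φ t = 0 := fun t ht => by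
    simp only [hΦ_def]
    rw [hΞ0 _ (by rwa [le_div_iff₀ hl2]), mul_zero]
  -- the identity
  have key := h.localEnergy_identity_radial hα hΦ1 hΦT
  -- constants: `(2l)^{2α−3} = 4^{α−3/2} l^{2α−3}`
  have h4 : (4 : ℝ) ^ (α - 3 / 2) * l ^ (2 * α - 3) = (2 * l) ^ (2 * α - 3) := by
    rw [Real.mul_rpow (by norm_num) hl.le, show (2 * α - 3) = 2 * (α - 3 / 2) by ring,
      Real.rpow_mul (by norm_num : (0 : ℝ) ≤ 2)]
    norm_num
  -- the weight, pointwise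
  have hW : ∀ y : EuclideanSpace ℝ (Fin 3),
      ((2 * α - 3) * Φ (‖y‖ ^ 2) - 2 * ‖y‖ ^ 2 * deriv Φ (‖y‖ ^ 2)) * ‖U y‖ ^ 2 =
        (2 * l) ^ (2 * α - 3) *
            (Real.smoothTransition (2 - 2 * (‖y‖ ^ 2 / (2 * l) ^ 2)) * ‖U y‖ ^ 2) -
          l ^ (2 * α - 3) * (Real.smoothTransition (2 - 2 * (‖y‖ ^ 2 / l ^ 2)) * ‖U y‖ ^ 2) := by
    intro y
    have hl0 : l ≠ 0 := hl.ne'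
    have hwu := hweight (‖y‖ ^ 2 / l ^ 2)
    have e1 : (2 * α - 3) * Φ (‖y‖ ^ 2) - 2 * ‖y‖ ^ 2 * deriv Φ (‖y‖ ^ 2) =
        l ^ (2 * α - 3) * (2 * (α - 3 / 2) * Ξ (‖y‖ ^ 2 / l ^ 2) -
          2 * (‖y‖ ^ 2 / l ^ 2) * deriv Ξ (‖y‖ ^ 2 / l ^ 2)) := by
      rw [hΦ']
      simp only [hΦ_def]
      field_simp
    rw [e1, hwu, show ‖y‖ ^ 2 / l ^ 2 / 4 = ‖y‖ ^ 2 / (2 * l) ^ 2 by ring, ← h4]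
    ring
  have hσi := integrable_cutoff_energy hUc hl (lam := l)
  have hσi2 := integrable_cutoff_energy hUc (by positivity : (0 : ℝ) < 2 * l) (lam := 2 * l)
  have hLHS : ∫ y, ((2 * α - 3) * Φ (‖y‖ ^ 2) - 2 * ‖y‖ ^ 2 * deriv Φ (‖y‖ ^ 2)) * ‖U y‖ ^ 2 =
      (2 * l) ^ (2 * α - 3) *
          (∫ y, Real.smoothTransition (2 - 2 * (‖y‖ ^ 2 / (2 * l) ^ 2)) * ‖U y‖ ^ 2) -
        l ^ (2 * α - 3) * (∫ y, Real.smoothTransition (2 - 2 * (‖y‖ ^ 2 / l ^ 2)) * ‖U y‖ ^ 2) := by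
    rw [← MeasureTheory.integral_const_mul, ← MeasureTheory.integral_const_mul,
      ← integral_sub (hσi2.const_mul _) (hσi.const_mul _)]
    exact integral_congr_ae (Eventually.of_forall hW)
  -- the flux side
  set S : Set (EuclideanSpace ℝ (Fin 3)) :=
    {y | l ^ 2 / 2 ≤ ‖y‖ ^ 2 ∧ ‖y‖ ^ 2 ≤ 4 * l ^ 2} with hS_def
  have hSm : MeasurableSet S :=
    (measurableSet_le measurable_const (continuous_norm.pow 2).measurable).inter
      (measurableSet_le (continuous_norm.pow 2).measurable measurable_const)
  have hScpt : IsCompact S := by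
    refine (isCompact_closedBall (0 : EuclideanSpace ℝ (Fin 3)) (2 * l)).of_isClosed_subset
      ((isClosed_le continuous_const (continuous_norm.pow 2)).inter
        (isClosed_le (continuous_norm.pow 2) continuous_const)) fun y hy => ?_
    rw [mem_closedBall, dist_zero_right]
    nlinarith [hy.2, norm_nonneg y]
  set f : EuclideanSpace ℝ (Fin 3) → ℝ := fun y => ‖U y‖ ^ 3 + 2 * (|P y| * ‖U y‖) with hf_def
  have hfc : Continuous f := (hUc.norm.pow 3).add (continuous_const.mul
    ((continuous_abs.comp hPc).mul hUc.norm))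
  have hf0 : ∀ y, 0 ≤ f y := fun y => by positivity
  have hfS : IntegrableOn f S volume := hfc.continuousOn.integrableOn_compact hScpt
  set g : EuclideanSpace ℝ (Fin 3) → ℝ :=
    fun y => (‖U y‖ ^ 2 + 2 * P y) * (2 * deriv Φ (‖y‖ ^ 2) * ⟪y, U y⟫) with hg_def
  -- `l^{2α−3}/l² · (2l) = 2 l^{2α−4}`
  have hpow : l ^ (2 * α - 3) / l ^ 2 * (2 * l) = 2 * l ^ (2 * α - 4) := by
    rw [show 2 * α - 4 = (2 * α - 3) - 1 by ring, Real.rpow_sub_one hl.ne']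
    field_simp
  have hpow0 : 0 ≤ l ^ (2 * α - 3) / l ^ 2 := by positivity
  have hbound : ∀ y, ‖g y‖ ≤ S.indicator (fun y => 4 * M * l ^ (2 * α - 4) * f y) y := by
    intro y
    by_cases hy : y ∈ S
    · rw [indicator_of_mem hy, Real.norm_eq_abs, hg_def]
      simp only
      rw [abs_mul, abs_mul, abs_mul, abs_two, hΦ']
      have hy2 : ‖y‖ ≤ 2 * l := by nlinarith [hy.2, norm_nonneg y, hl]
      have hin : |⟪y, U y⟫| ≤ ‖y‖ * ‖U y‖ := abs_real_inner_le_norm _ _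
      have hA : |‖U y‖ ^ 2 + 2 * P y| ≤ ‖U y‖ ^ 2 + 2 * |P y| := by
        calc |‖U y‖ ^ 2 + 2 * P y| ≤ |‖U y‖ ^ 2| + |2 * P y| := abs_add_le _ _
          _ = ‖U y‖ ^ 2 + 2 * |P y| := by rw [abs_of_nonneg (by positivity), abs_mul, abs_two]
      have hD' : |l ^ (2 * α - 3) / l ^ 2 * deriv Ξ (‖y‖ ^ 2 / l ^ 2)| ≤
          l ^ (2 * α - 3) / l ^ 2 * M := by
        rw [abs_mul, abs_of_nonneg hpow0]
        exact mul_le_mul_of_nonneg_left (hM _) hpow0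
      calc |‖U y‖ ^ 2 + 2 * P y| * (2 * |l ^ (2 * α - 3) / l ^ 2 * deriv Ξ (‖y‖ ^ 2 / l ^ 2)| *
              |⟪y, U y⟫|)
          ≤ (‖U y‖ ^ 2 + 2 * |P y|) * (2 * (l ^ (2 * α - 3) / l ^ 2 * M) * (‖y‖ * ‖U y‖)) := by
            gcongr
        _ ≤ (‖U y‖ ^ 2 + 2 * |P y|) * (2 * (l ^ (2 * α - 3) / l ^ 2 * M) * ((2 * l) * ‖U y‖)) := by
            gcongr
        _ = M * (l ^ (2 * α - 3) / l ^ 2 * (2 * l)) * (2 * f y) := by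
            rw [hf_def]; ring
        _ = 4 * M * l ^ (2 * α - 4) * f y := by rw [hpow]; ring
    · rw [indicator_of_notMem hy]
      have hΦ0 : deriv Φ (‖y‖ ^ 2) = 0 := by
        rw [hΦ']
        simp only [hS_def, mem_setOf_eq, not_and_or, not_le] at hy
        rcases hy with hy | hy
        · rw [hlo _ (by rw [div_le_iff₀ hl2]; linarith), mul_zero]
        · rw [hhi _ (by rw [le_div_iff₀ hl2]; linarith), mul_zero]
      simp [hg_def, hΦ0]
  have hGi : Integrable (S.indicator fun y => 4 * M * l ^ (2 * α - 4) * f y) volume :=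
    IntegrableOn.integrable_indicator (Integrable.const_mul hfS _) hSm
  have hflux : ‖∫ y, g y‖ ≤ 4 * M * l ^ (2 * α - 4) * ∫ y in S, f y := by
    calc ‖∫ y, g y‖ ≤ ∫ y, S.indicator (fun y => 4 * M * l ^ (2 * α - 4) * f y) y :=
          norm_integral_le_of_norm_le hGi (Eventually.of_forall hbound)
      _ = 4 * M * l ^ (2 * α - 4) * ∫ y in S, f y := by
          rw [MeasureTheory.integral_indicator hSm, MeasureTheory.integral_const_mul]
  -- assemble
  rw [← hLHS, key]
  calc |(1 + α) * ∫ y, g y| = |1 + α| * ‖∫ y, g y‖ := by rw [abs_mul, Real.norm_eq_abs]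
    _ ≤ |1 + α| * (4 * M * l ^ (2 * α - 4) * ∫ y in S, f y) :=
        mul_le_mul_of_nonneg_left hflux (abs_nonneg _)
    _ = |1 + α| * (4 * M) * l ^ (2 * α - 4) * ∫ y in S, f y := by ring


/-- **Chae–Shvydkoy 2013, eq. (2.9), for dyadic ratios `l₂ = 2^k l₁`.** With
`E(λ) = λ^{2α−3} ∫ σ(|y|²/λ²)|U|²`: for all `l > 0` and `k ∈ ℕ`,
`|E(2^k l) − E(l)| ≤ C Σ_{j<k} (2^j l)^{2α−4} ∫_{(2^j l)²/2 ≤ |y|² ≤ 4(2^j l)²} (|U|³ + 2|P||U|)`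
(telescoping `twoScale_energy_step`; on the `j`-th shell `(2^j l)^{2α−4} ≈ |y|^{2α−N−1}`, so the
right-hand side is CS13's `C ∫_{l₁/2 ≤ |y| ≤ l₂} (|v|³ + |q||v|)|y|^{2α−N−1} dy` up to the bounded
overlap of the shells). [cite: ChaeShvydkoy2013, §2.2 eq. (2.9)] -/
theorem IsSelfSimilarEulerProfile.twoScale_energy_dyadic {α : ℝ}
    {U : EuclideanSpace ℝ (Fin 3) → EuclideanSpace ℝ (Fin 3)} {P : EuclideanSpace ℝ (Fin 3) → ℝ}
    (h : IsSelfSimilarEulerProfile (1 / (α + 1)) 0 U P) (hα : α + 1 ≠ 0) :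
    ∃ C : ℝ, 0 ≤ C ∧ ∀ l : ℝ, 0 < l → ∀ k : ℕ,
      |(2 ^ k * l) ^ (2 * α - 3) *
            (∫ y, Real.smoothTransition (2 - 2 * (‖y‖ ^ 2 / (2 ^ k * l) ^ 2)) * ‖U y‖ ^ 2) -
          l ^ (2 * α - 3) * (∫ y, Real.smoothTransition (2 - 2 * (‖y‖ ^ 2 / l ^ 2)) * ‖U y‖ ^ 2)| ≤
        C * ∑ j ∈ Finset.range k, (2 ^ j * l) ^ (2 * α - 4) *
          ∫ y in {y : EuclideanSpace ℝ (Fin 3) |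
              (2 ^ j * l) ^ 2 / 2 ≤ ‖y‖ ^ 2 ∧ ‖y‖ ^ 2 ≤ 4 * (2 ^ j * l) ^ 2},
            (‖U y‖ ^ 3 + 2 * (|P y| * ‖U y‖)) := by
  obtain ⟨C, hC0, hstep⟩ := h.twoScale_energy_step hα
  refine ⟨C, hC0, fun l hl => ?_⟩
  set E : ℝ → ℝ := fun lam =>
    lam ^ (2 * α - 3) * ∫ y, Real.smoothTransition (2 - 2 * (‖y‖ ^ 2 / lam ^ 2)) * ‖U y‖ ^ 2
    with hE_def
  set B : ℝ → ℝ := fun lam => lam ^ (2 * α - 4) *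
    ∫ y in {y : EuclideanSpace ℝ (Fin 3) | lam ^ 2 / 2 ≤ ‖y‖ ^ 2 ∧ ‖y‖ ^ 2 ≤ 4 * lam ^ 2},
      (‖U y‖ ^ 3 + 2 * (|P y| * ‖U y‖)) with hB_def
  have hstep' : ∀ lam, 0 < lam → |E (2 * lam) - E lam| ≤ C * B lam := fun lam hlam => by
    have := hstep lam hlam
    simp only [hE_def, hB_def]
    rw [mul_assoc] at this
    exact this
  intro k
  change |E (2 ^ k * l) - E l| ≤ C * ∑ j ∈ Finset.range k, B (2 ^ j * l)
  induction k with
  | zero => simp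
  | succ k ih =>
    have hk : (0 : ℝ) < 2 ^ k * l := by positivity
    rw [Finset.sum_range_succ, mul_add, pow_succ, show (2 : ℝ) ^ k * 2 * l = 2 * (2 ^ k * l) by ring]
    calc |E (2 * (2 ^ k * l)) - E l|
        = |(E (2 * (2 ^ k * l)) - E (2 ^ k * l)) + (E (2 ^ k * l) - E l)| := by ring_nf
      _ ≤ |E (2 * (2 ^ k * l)) - E (2 ^ k * l)| + |E (2 ^ k * l) - E l| := abs_add_le _ _
      _ ≤ C * B (2 ^ k * l) + C * ∑ j ∈ Finset.range k, B (2 ^ j * l) :=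
          add_le_add (hstep' _ hk) ih
      _ = C * ∑ j ∈ Finset.range k, B (2 ^ j * l) + C * B (2 ^ k * l) := add_comm _ _

end Literature.Analysis.FluidPDE

end
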